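import Summits.QuantumFields.QCD.Theorems.PauliWegnerSeaFMClosureUnquenchedTwoStarC1

/-!
# Crux `GaussianLinkFrames.FrameFMClosure` (stmt-QuantumFields-17375), line `pad-the-fibre`, stub
`stub_twoStarOfPadded` — helper 5: bipartite balance by pairings, stability of touched regions, and the geometry of
even `4⁴` pads on the odd torus

Generic, definition-free lemmas for the placement combinatorics of the padded cofactor domination (the skeleton's
`Balanced`, `touched`, `starLinks`, `padLinks` are written out: `Cruxes/…` is not importable from `Theorems/`, and
the bodies below are theirs verbatim).

* §1 `card_filter_eq_of_pairing`: a site set `X` carrying a nearest-neighbour pairing `σ` (`σ(X) ⊆ X`, `σσ = id` on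
  `X`, `σ z = z ± e_μ`) has equal colour classes under every proper two-colouring — the perfect-matching proof of
  bipartite balance (no connectivity argument).
* §2 `balanced_touched_of_blocks`: if every link of `R` joins two sites of a block `P₁` or two sites of a block `P₂`,
  every nearest-neighbour link inside a block belongs to `R`, and `σ` pairs `Pᵢ ∩ A` inside itself, then the touched
  region `{z ∈ A : z is an endpoint of a link of R inside A}` is `σ`-stable, hence balanced.
* §3 `dom_sup_of_forall_exists`: the `∀ W ∃ W'` form of a domination inequality along a refit fibre gives the
  `sup`-form consumed by helpers 1–4.
* §4 pads: membership in `ebox S c r`, the core `ebox S c 0` and its neighbours lie in the pad `ebox S c 1`, and the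
  flip `τ_c` of the `0`-coordinate inside the aligned pairs `{c₀-2, c₀-1}`, `{c₀, c₀+1}` is a nearest-neighbour
  pairing of the pad (`S ≥ 2`); two pads whose `0`-offset is an even integer (read through a small representative,
  `S ≥ 4`) have the same flip on their overlap.

References: bipartite balance / domino pairings are standard [folklore]; the pad recipe is the line card of
`pad-the-fibre` (triage r1-1, sharpen 1).
-/

noncomputable section

open scoped BigOperators
open Literature.MathematicalPhysics.QuantumFieldTheory Literature.MathematicalPhysics.QuantumLattice
  Literature.Probability.LatticeModels
open Summit.QuantumFields.QCD.Theorems.VonMisesCircles Summit.QuantumFields.QCD.Theorems.VonMisesCirclesC1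

namespace Summit.QuantumFields.QCD.Theorems.PadTheFibreTwoStar

/-! ## §1 Balance from a nearest-neighbour pairing -/

/-- **Balance by pairing.**  If `σ` maps `X` into itself, is an involution on `X` and moves every site of `X` to a
nearest neighbour (`σ z = z + e_μ` or `z = σ z + e_μ`), then every proper two-colouring of `X` has colour classes of
equal size: `σ` swaps the two classes. [folklore] -/
theorem card_filter_eq_of_pairing {N : ℕ} (X : Finset (TorusSite 4 N)) (σ : TorusSite 4 N → TorusSite 4 N)
    (hσX : ∀ z ∈ X, σ z ∈ X) (hσσ : ∀ z ∈ X, σ (σ z) = z)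
    (hadj : ∀ z ∈ X, ∃ μ : Fin 4, σ z = z + Pi.single μ 1 ∨ z = σ z + Pi.single μ 1)
    (χ : TorusSite 4 N → Bool)
    (hχ : ∀ z ∈ X, ∀ μ : Fin 4, z + Pi.single μ 1 ∈ X → χ z ≠ χ (z + Pi.single μ 1)) :
    (X.filter fun z => χ z = true).card = (X.filter fun z => χ z = false).card := by
  have hne : ∀ z ∈ X, χ (σ z) ≠ χ z := by
    intro z hz
    obtain ⟨μ, h | h⟩ := hadj z hz
    · have h1 := hχ z hz μ (h ▸ hσX z hz)
      rw [← h] at h1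
      exact fun h2 => h1 h2.symm
    · have h1 := hχ (σ z) (hσX z hz) μ (h ▸ hz)
      rw [← h] at h1
      exact h1
  refine Finset.card_nbij' σ σ ?_ ?_ (fun z hz => hσσ z (Finset.mem_filter.1 hz).1)
    (fun z hz => hσσ z (Finset.mem_filter.1 hz).1)
  · intro z hz
    rw [Finset.mem_coe, Finset.mem_filter] at hz ⊢
    refine ⟨hσX z hz.1, ?_⟩
    have h := hne z hz.1
    rw [hz.2] at h
    simpa using h
  · intro z hz
    rw [Finset.mem_coe, Finset.mem_filter] at hz ⊢
    refine ⟨hσX z hz.1, ?_⟩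
    have h := hne z hz.1
    rw [hz.2] at h
    simpa using h

/-! ## §2 Touched regions of block-structured link sets -/

/-- **Balance of a touched region from a block pairing.**  Let every link of `R` join two sites of `P₁` or two
sites of `P₂`, let every nearest-neighbour link inside `P₁` and inside `P₂` belong to `R`, and let `σ` be a
nearest-neighbour involution pairing `P₁ ∩ A` inside `P₁ ∩ A` and `P₂ ∩ A` inside `P₂ ∩ A`.  Then the touched region
`X = {z ∈ A : z is an endpoint of a link of R with both endpoints in A}` (the skeleton's `touched S A R`, written
out) is balanced: every proper two-colouring of `X` has equal colour classes (the skeleton's `Balanced X`, written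
out). [folklore] -/
theorem balanced_touched_of_blocks {N : ℕ} (A : Finset (TorusSite 4 N)) (R : Finset (Edge 4 N))
    (P₁ P₂ : Finset (TorusSite 4 N)) (σ : TorusSite 4 N → TorusSite 4 N)
    (hR : ∀ e ∈ R, (e.1 ∈ P₁ ∧ Site.shift e.1 e.2 ∈ P₁) ∨ (e.1 ∈ P₂ ∧ Site.shift e.1 e.2 ∈ P₂))
    (hP₁ : ∀ (z : TorusSite 4 N) (μ : Fin 4), z ∈ P₁ → z + Pi.single μ 1 ∈ P₁ → ((z, μ) : Edge 4 N) ∈ R)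
    (hP₂ : ∀ (z : TorusSite 4 N) (μ : Fin 4), z ∈ P₂ → z + Pi.single μ 1 ∈ P₂ → ((z, μ) : Edge 4 N) ∈ R)
    (hσ₁ : ∀ z ∈ P₁, z ∈ A → σ z ∈ P₁ ∧ σ z ∈ A)
    (hσ₂ : ∀ z ∈ P₂, z ∈ A → σ z ∈ P₂ ∧ σ z ∈ A)
    (hσσ : ∀ z ∈ P₁ ∪ P₂, z ∈ A → σ (σ z) = z)
    (hadj : ∀ z ∈ P₁ ∪ P₂, z ∈ A → ∃ μ : Fin 4, σ z = z + Pi.single μ 1 ∨ z = σ z + Pi.single μ 1)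
    (χ : TorusSite 4 N → Bool) :
    (∀ z ∈ A.filter (fun z => ∃ e ∈ R, e.1 ∈ A ∧ Site.shift e.1 e.2 ∈ A ∧ (e.1 = z ∨ Site.shift e.1 e.2 = z)),
      ∀ μ : Fin 4, z + Pi.single μ 1 ∈
        A.filter (fun z => ∃ e ∈ R, e.1 ∈ A ∧ Site.shift e.1 e.2 ∈ A ∧ (e.1 = z ∨ Site.shift e.1 e.2 = z)) →
        χ z ≠ χ (z + Pi.single μ 1)) →
    ((A.filter (fun z => ∃ e ∈ R, e.1 ∈ A ∧ Site.shift e.1 e.2 ∈ A ∧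
        (e.1 = z ∨ Site.shift e.1 e.2 = z))).filter fun z => χ z = true).card =
      ((A.filter (fun z => ∃ e ∈ R, e.1 ∈ A ∧ Site.shift e.1 e.2 ∈ A ∧
        (e.1 = z ∨ Site.shift e.1 e.2 = z))).filter fun z => χ z = false).card := by
  intro hχ
  set X : Finset (TorusSite 4 N) := A.filter (fun z => ∃ e ∈ R, e.1 ∈ A ∧ Site.shift e.1 e.2 ∈ A ∧
    (e.1 = z ∨ Site.shift e.1 e.2 = z)) with hXdef
  -- every touched site lies in a block
  have hblk : ∀ z ∈ X, z ∈ A ∧ (z ∈ P₁ ∨ z ∈ P₂) := by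
    intro z hz
    rw [hXdef, Finset.mem_filter] at hz
    obtain ⟨hzA, e, heR, -, -, hez⟩ := hz
    refine ⟨hzA, ?_⟩
    rcases hR e heR with ⟨h1, h2⟩ | ⟨h1, h2⟩
    · left; rcases hez with h | h <;> [exact h ▸ h1; exact h ▸ h2]
    · right; rcases hez with h | h <;> [exact h ▸ h1; exact h ▸ h2]
  -- a block site of `A` whose partner is a block site of `A` is touched (by the link to its partner)
  have htouch : ∀ (P : Finset (TorusSite 4 N)),
      (∀ (z : TorusSite 4 N) (μ : Fin 4), z ∈ P → z + Pi.single μ 1 ∈ P → ((z, μ) : Edge 4 N) ∈ R) →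
      ∀ z w : TorusSite 4 N, z ∈ P → z ∈ A → w ∈ P → w ∈ A →
        (∃ μ : Fin 4, w = z + Pi.single μ 1 ∨ z = w + Pi.single μ 1) → w ∈ X := by
    intro P hP z w hzP hzA hwP hwA hμ
    rw [hXdef, Finset.mem_filter]
    refine ⟨hwA, ?_⟩
    obtain ⟨μ, h | h⟩ := hμ
    · refine ⟨(z, μ), hP z μ hzP (h ▸ hwP), hzA, ?_, Or.inr ?_⟩
      · show z + Pi.single μ 1 ∈ A
        exact h ▸ hwA
      · show z + Pi.single μ 1 = w
        exact h.symm
    · refine ⟨(w, μ), hP w μ hwP (h ▸ hzP), hwA, ?_, Or.inl rfl⟩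
      show w + Pi.single μ 1 ∈ A
      exact h ▸ hzA
  have hσX : ∀ z ∈ X, σ z ∈ X := by
    intro z hz
    obtain ⟨hzA, hz1 | hz2⟩ := hblk z hz
    · obtain ⟨h1, h2⟩ := hσ₁ z hz1 hzA
      exact htouch P₁ hP₁ z (σ z) hz1 hzA h1 h2
        (hadj z (Finset.mem_union_left _ hz1) hzA |>.imp fun μ h => h)
    · obtain ⟨h1, h2⟩ := hσ₂ z hz2 hzA
      exact htouch P₂ hP₂ z (σ z) hz2 hzA h1 h2
        (hadj z (Finset.mem_union_right _ hz2) hzA |>.imp fun μ h => h)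
  have hPU : ∀ z ∈ X, z ∈ P₁ ∪ P₂ ∧ z ∈ A := fun z hz =>
    ⟨by rcases (hblk z hz).2 with h | h <;> [exact Finset.mem_union_left _ h;
      exact Finset.mem_union_right _ h], (hblk z hz).1⟩
  exact card_filter_eq_of_pairing X σ hσX (fun z hz => hσσ z (hPU z hz).1 (hPU z hz).2)
    (fun z hz => hadj z (hPU z hz).1 (hPU z hz).2) χ hχ

/-! ## §3 From the `∀ W ∃ W'` form of domination to the `sup` form -/

/-- Along a refit fibre, `‖adj_{ab}(W)‖₁ ≤ C₀ |det(W')|` for SOME `W'` on the fibre (every `W`) gives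
`‖adj_{ab}(W)‖₁ ≤ C₀ sup_fibre |det|` (the supremum over the compact fibre bounds every value; `0 ≤ C₀`). [folklore] -/
theorem dom_sup_of_forall_exists {S : ℕ} (A : Finset (TorusSite 4 (2 * S + 1))) (m₀ C₀ : ℝ) (hC₀ : 0 ≤ C₀)
    (a b : TorusSite 4 (2 * S + 1)) (R : Finset (Edge 4 (2 * S + 1)))
    (U : GaugeConfig 4 (2 * S + 1) (Matrix.specialUnitaryGroup (Fin 3) ℂ))
    (h : ∀ W : GaugeConfig 4 (2 * S + 1) (Matrix.specialUnitaryGroup (Fin 3) ℂ),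
      ∃ W' : GaugeConfig 4 (2 * S + 1) (Matrix.specialUnitaryGroup (Fin 3) ℂ),
        blockNorm ((sideMatrix A (wilsonD (fun e => if e ∈ R then W e else U e) m₀)).adjugate) a b ≤
          C₀ * ‖(sideMatrix A (wilsonD (fun e => if e ∈ R then W' e else U e) m₀)).det‖)
    (W : GaugeConfig 4 (2 * S + 1) (Matrix.specialUnitaryGroup (Fin 3) ℂ)) :
    blockNorm ((sideMatrix A (wilsonD (fun e => if e ∈ R then W e else U e) m₀)).adjugate) a b ≤
      C₀ * ⨆ W' : GaugeConfig 4 (2 * S + 1) (Matrix.specialUnitaryGroup (Fin 3) ℂ),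
        ‖(sideMatrix A (wilsonD (fun e => if e ∈ R then W' e else U e) m₀)).det‖ := by
  obtain ⟨W', hW'⟩ := h W
  have hcont : Continuous fun W' : GaugeConfig 4 (2 * S + 1) (Matrix.specialUnitaryGroup (Fin 3) ℂ) =>
      ‖(sideMatrix A (wilsonD (fun e => if e ∈ R then W' e else U e) m₀)).det‖ :=
    ((continuous_sideMatrix_wilsonD A m₀).comp (continuous_refit R U)).matrix_det.norm
  exact hW'.trans (mul_le_mul_of_nonneg_left (le_ciSup (isCompact_range hcont).bddAbove W') hC₀)

/-! ## §4 Even pads on the odd torus -/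

/-- Membership in the even box `ebox S c r`: `z = c + proj w` with `w ∈ {-r-1,…,r}⁴`. [folklore] -/
theorem mem_ebox_iff {S : ℕ} (c z : TorusSite 4 (2 * S + 1)) (r : ℕ) :
    z ∈ ebox S c r ↔ ∃ w : Site 4, (∀ i, -(r : ℤ) - 1 ≤ w i ∧ w i ≤ r) ∧ z = c + Torus.proj (2 * S + 1) w := by
  simp only [ebox, Finset.mem_image, Fintype.mem_piFinset, Finset.mem_Icc]
  exact ⟨fun ⟨w, hw, h⟩ => ⟨w, hw, h.symm⟩, fun ⟨w, hw, h⟩ => ⟨w, hw, h.symm⟩⟩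

/-- `proj (w + e_μ) = proj w + e_μ` and `proj (w - e_μ) = proj w - e_μ` on the torus. [folklore] -/
theorem proj_add_single_sub_single (L : ℕ) (w : Site 4) (μ : Fin 4) :
    Torus.proj L (w + Pi.single μ 1) = Torus.proj L w + Pi.single μ 1 ∧
      Torus.proj L (w - Pi.single μ 1) = Torus.proj L w - Pi.single μ 1 := by
  constructor <;> funext j <;> by_cases h : j = μ
  · subst h; simp
  · simp [h]
  · subst h; simp
  · simp [h]

/-- A site in the `2⁴` core `ebox S c 0` of a pad, and all its neighbours, lie in the pad `ebox S c 1`. [folklore] -/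
theorem core_and_nbrs_subset_pad {S : ℕ} (c x : TorusSite 4 (2 * S + 1)) (hx : x ∈ ebox S c 0) :
    x ∈ ebox S c 1 ∧ ∀ μ : Fin 4, x + Pi.single μ 1 ∈ ebox S c 1 ∧ x - Pi.single μ 1 ∈ ebox S c 1 := by
  rw [mem_ebox_iff] at hx
  obtain ⟨w, hw, rfl⟩ := hx
  have hw' : ∀ i, -1 ≤ w i ∧ w i ≤ 0 := fun i => by have := hw i; push_cast at this; exact this
  have cast1 : ∀ v : Site 4, (∀ i, -2 ≤ v i ∧ v i ≤ 1) → (∀ i, -((1 : ℕ) : ℤ) - 1 ≤ v i ∧ v i ≤ ((1 : ℕ) : ℤ)) :=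
    fun v hv i => by push_cast; constructor <;> linarith [(hv i).1, (hv i).2]
  refine ⟨(mem_ebox_iff _ _ _).2 ⟨w, cast1 w fun i => ⟨by linarith [(hw' i).1], by linarith [(hw' i).2]⟩, rfl⟩,
    fun μ => ⟨?_, ?_⟩⟩
  · refine (mem_ebox_iff _ _ _).2 ⟨w + Pi.single μ 1, cast1 _ fun i => ?_, ?_⟩
    · by_cases h : i = μ
      · subst h; simp only [Pi.add_apply, Pi.single_eq_same]; constructor <;> linarith [(hw' i).1, (hw' i).2]
      · simp only [Pi.add_apply, Pi.single_eq_of_ne h, add_zero]; constructor <;> linarith [(hw' i).1, (hw' i).2]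
    · rw [(proj_add_single_sub_single _ w μ).1, add_assoc]
  · refine (mem_ebox_iff _ _ _).2 ⟨w - Pi.single μ 1, cast1 _ fun i => ?_, ?_⟩
    · by_cases h : i = μ
      · subst h; simp only [Pi.sub_apply, Pi.single_eq_same]; constructor <;> linarith [(hw' i).1, (hw' i).2]
      · simp only [Pi.sub_apply, Pi.single_eq_of_ne h, sub_zero]; constructor <;> linarith [(hw' i).1, (hw' i).2]
    · rw [(proj_add_single_sub_single _ w μ).2, add_sub_assoc]

/-- Small integers are read off their residues: if `|a - b| < L` then `(a : ZMod L) = b ↔ a = b`. [folklore] -/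
theorem intCast_eq_intCast_iff_of_abs_sub_lt {L : ℕ} {a b : ℤ} (h : |a - b| < L) :
    ((a : ZMod L) = (b : ZMod L)) ↔ a = b := by
  refine ⟨fun hab => ?_, fun hab => by rw [hab]⟩
  rw [ZMod.intCast_eq_intCast_iff_dvd_sub] at hab
  have h0 : b - a = 0 := Int.eq_zero_of_abs_lt_dvd hab (by rwa [abs_sub_comm])
  linarith

/-- Reading the `0`-offset of a pad site off its residue (`S ≥ 2`): for `z = c + proj v`, `v ∈ {-2,…,1}⁴`, and
`k ∈ {-2,…,1}`, `z₀ - c₀ = k (mod 2S+1) ↔ v₀ = k`. [folklore] -/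
theorem pad_coord_zero_iff {S : ℕ} (hS : 2 ≤ S) (c : TorusSite 4 (2 * S + 1)) (v : Site 4)
    (hv : ∀ i, -2 ≤ v i ∧ v i ≤ 1) (k : ℤ) (hk1 : -2 ≤ k) (hk2 : k ≤ 1) :
    ((c + Torus.proj (2 * S + 1) v) 0 - c 0 = (k : ZMod (2 * S + 1))) ↔ v 0 = k := by
  have hL : (4 : ℤ) < ((2 * S + 1 : ℕ) : ℤ) := by push_cast; omega
  have e : (c + Torus.proj (2 * S + 1) v) 0 - c 0 = ((v 0 : ℤ) : ZMod (2 * S + 1)) := by simp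
  rw [e]
  exact intCast_eq_intCast_iff_of_abs_sub_lt (by
    rw [abs_lt]; constructor <;> push_cast <;> linarith [(hv 0).1, (hv 0).2])

/-- **The `0`-flip of a pad is a nearest-neighbour pairing** (`S ≥ 2`).  On the pad `ebox S c 1 = c + {-2,…,1}⁴`
the map `τ_c z = z + e₀` if `z₀ - c₀ ∈ {-2, 0}`, `τ_c z = z - e₀` otherwise, maps the pad into itself, is an
involution there, and moves every site to a `0`-neighbour. [folklore] -/
theorem pad_flip {S : ℕ} (hS : 2 ≤ S) (c : TorusSite 4 (2 * S + 1)) :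
    let τ : TorusSite 4 (2 * S + 1) → TorusSite 4 (2 * S + 1) := fun z =>
      if z 0 - c 0 = -2 ∨ z 0 - c 0 = 0 then z + Pi.single 0 1 else z - Pi.single 0 1
    ∀ z ∈ ebox S c 1, τ z ∈ ebox S c 1 ∧ τ (τ z) = z ∧
      (τ z = z + Pi.single 0 1 ∨ z = τ z + Pi.single 0 1) := by
  intro τ z hz
  rw [mem_ebox_iff] at hz
  obtain ⟨w, hw0, rfl⟩ := hz
  have hw : ∀ i, -2 ≤ w i ∧ w i ≤ 1 := fun i => by have := hw0 i; push_cast at this; exact this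
  have cast1 : ∀ v : Site 4, (∀ i, -2 ≤ v i ∧ v i ≤ 1) → (∀ i, -((1 : ℕ) : ℤ) - 1 ≤ v i ∧ v i ≤ ((1 : ℕ) : ℤ)) :=
    fun v hv i => by push_cast; constructor <;> linarith [(hv i).1, (hv i).2]
  have key : ∀ v : Site 4, (∀ i, -2 ≤ v i ∧ v i ≤ 1) → ∀ k : ℤ, -2 ≤ k → k ≤ 1 →
      (((c + Torus.proj (2 * S + 1) v) 0 - c 0 = (k : ZMod (2 * S + 1))) ↔ v 0 = k) :=
    fun v hv k hk1 hk2 => pad_coord_zero_iff hS c v hv k hk1 hk2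
  have hτdef : ∀ v : Site 4, τ (c + Torus.proj (2 * S + 1) v) =
      if (c + Torus.proj (2 * S + 1) v) 0 - c 0 = -2 ∨ (c + Torus.proj (2 * S + 1) v) 0 - c 0 = 0 then
        c + Torus.proj (2 * S + 1) v + Pi.single 0 1 else c + Torus.proj (2 * S + 1) v - Pi.single 0 1 :=
    fun v => rfl
  -- the two moves inside the pad
  have up : ∀ v : Site 4, (∀ i, -2 ≤ v i ∧ v i ≤ 1) → v 0 ≤ 0 →
      c + Torus.proj (2 * S + 1) v + Pi.single 0 1 = c + Torus.proj (2 * S + 1) (v + Pi.single 0 1) ∧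
      (∀ i, -2 ≤ (v + Pi.single 0 1 : Site 4) i ∧ (v + Pi.single 0 1 : Site 4) i ≤ 1) ∧
        (v + Pi.single 0 1 : Site 4) 0 = v 0 + 1 := by
    intro v hv h0
    refine ⟨by rw [(proj_add_single_sub_single _ v 0).1, add_assoc], fun i => ?_, by simp⟩
    by_cases h : i = 0
    · subst h; simp only [Pi.add_apply, Pi.single_eq_same]; constructor <;> linarith [(hv 0).1]
    · simp only [Pi.add_apply, Pi.single_eq_of_ne h, add_zero]; exact hv i
  have dn : ∀ v : Site 4, (∀ i, -2 ≤ v i ∧ v i ≤ 1) → -1 ≤ v 0 →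
      c + Torus.proj (2 * S + 1) v - Pi.single 0 1 = c + Torus.proj (2 * S + 1) (v - Pi.single 0 1) ∧
      (∀ i, -2 ≤ (v - Pi.single 0 1 : Site 4) i ∧ (v - Pi.single 0 1 : Site 4) i ≤ 1) ∧
        (v - Pi.single 0 1 : Site 4) 0 = v 0 - 1 := by
    intro v hv h0
    refine ⟨by rw [(proj_add_single_sub_single _ v 0).2, add_sub_assoc], fun i => ?_, by simp⟩
    by_cases h : i = 0
    · subst h; simp only [Pi.sub_apply, Pi.single_eq_same]; constructor <;> linarith [(hv 0).2]
    · simp only [Pi.sub_apply, Pi.single_eq_of_ne h, sub_zero]; exact hv i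
  have k2 := key w hw (-2) (by norm_num) (by norm_num)
  have k0 := key w hw 0 (by norm_num) (by norm_num)
  push_cast at k2 k0
  by_cases hc : w 0 = -2 ∨ w 0 = 0
  · -- move up, then back down
    have hcond : (c + Torus.proj (2 * S + 1) w) 0 - c 0 = -2 ∨ (c + Torus.proj (2 * S + 1) w) 0 - c 0 = 0 := by
      rcases hc with h | h <;> [exact Or.inl (k2.2 h); exact Or.inr (k0.2 h)]
    have h1 : τ (c + Torus.proj (2 * S + 1) w) = c + Torus.proj (2 * S + 1) w + Pi.single 0 1 := by
      rw [hτdef, if_pos hcond]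
    obtain ⟨e1, hw', h0'⟩ := up w hw (by rcases hc with h | h <;> omega)
    have hcond' : ¬((c + Torus.proj (2 * S + 1) (w + Pi.single 0 1 : Site 4)) 0 - c 0 = -2 ∨
        (c + Torus.proj (2 * S + 1) (w + Pi.single 0 1 : Site 4)) 0 - c 0 = 0) := by
      have k2' := key _ hw' (-2) (by norm_num) (by norm_num)
      have k0' := key _ hw' 0 (by norm_num) (by norm_num)
      push_cast at k2' k0'
      rw [k2', k0', h0']
      rcases hc with h | h <;> omega
    refine ⟨?_, ?_, Or.inl h1⟩
    · rw [h1, e1]; exact (mem_ebox_iff _ _ _).2 ⟨_, cast1 _ hw', rfl⟩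
    · rw [h1, e1, hτdef, if_neg hcond', ← e1, add_sub_cancel_right]
  · -- move down, then back up
    have hcond : ¬((c + Torus.proj (2 * S + 1) w) 0 - c 0 = -2 ∨ (c + Torus.proj (2 * S + 1) w) 0 - c 0 = 0) := by
      rw [k2, k0]; exact hc
    have h1 : τ (c + Torus.proj (2 * S + 1) w) = c + Torus.proj (2 * S + 1) w - Pi.single 0 1 := by
      rw [hτdef, if_neg hcond]
    obtain ⟨e1, hw', h0'⟩ := dn w hw (by have := (hw 0).1; omega)
    have hcond' : (c + Torus.proj (2 * S + 1) (w - Pi.single 0 1 : Site 4)) 0 - c 0 = -2 ∨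
        (c + Torus.proj (2 * S + 1) (w - Pi.single 0 1 : Site 4)) 0 - c 0 = 0 := by
      have k2' := key _ hw' (-2) (by norm_num) (by norm_num)
      have k0' := key _ hw' 0 (by norm_num) (by norm_num)
      push_cast at k2' k0'
      rw [k2', k0', h0']
      have := (hw 0).1; have := (hw 0).2; omega
    refine ⟨?_, ?_, Or.inr ?_⟩
    · rw [h1, e1]; exact (mem_ebox_iff _ _ _).2 ⟨_, cast1 _ hw', rfl⟩
    · rw [h1, e1, hτdef, if_pos hcond', ← e1, sub_add_cancel]
    · rw [h1, sub_add_cancel]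

/-- **Registered helper `stub_twoStarOfPadded_aux5` of crux stmt-QuantumFields-17375** (line `pad-the-fibre`, stub
`stub_twoStarOfPadded`): the touched region of a block-structured link set with a block pairing is bipartite-balanced
(the skeleton's `Balanced (touched S A R)`, bodies written out) — the balance mechanism for padded placements. [folklore] -/
theorem stub_twoStarOfPadded_aux5 : ∀ (N : ℕ) (A : Finset (TorusSite 4 N)) (R : Finset (Edge 4 N)) (P₁ P₂ : Finset (TorusSite 4 N)) (σ : TorusSite 4 N → TorusSite 4 N), (∀ e ∈ R, (e.1 ∈ P₁ ∧ Site.shift e.1 e.2 ∈ P₁) ∨ (e.1 ∈ P₂ ∧ Site.shift e.1 e.2 ∈ P₂)) → (∀ (z : TorusSite 4 N) (μ : Fin 4), z ∈ P₁ → z + Pi.single μ 1 ∈ P₁ → ((z, μ) : Edge 4 N) ∈ R) → (∀ (z : TorusSite 4 N) (μ : Fin 4), z ∈ P₂ → z + Pi.single μ 1 ∈ P₂ → ((z, μ) : Edge 4 N) ∈ R) → (∀ z ∈ P₁, z ∈ A → σ z ∈ P₁ ∧ σ z ∈ A) → (∀ z ∈ P₂, z ∈ A → σ z ∈ P₂ ∧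 σ z ∈ A) → (∀ z ∈ P₁ ∪ P₂, z ∈ A → σ (σ z) = z) → (∀ z ∈ P₁ ∪ P₂, z ∈ A → ∃ μ : Fin 4, σ z = z + Pi.single μ 1 ∨ z = σ z + Pi.single μ 1) → ∀ (χ : TorusSite 4 N → Bool), (∀ z ∈ A.filter (fun z => ∃ e ∈ R, e.1 ∈ A ∧ Site.shift e.1 e.2 ∈ A ∧ (e.1 = z ∨ Site.shift e.1 e.2 = z)), ∀ μ : Fin 4, z + Pi.single μ 1 ∈ A.filter (fun z => ∃ e ∈ R, e.1 ∈ A ∧ Site.shift e.1 e.2 ∈ A ∧ (e.1 = z ∨ Site.shift e.1 e.2 = z)) → χ z ≠ χ (z + Pi.single μ 1)) → ((A.filter (fun z => ∃ e ∈ R, e.1 ∈ A ∧ Site.shift e.1 e.2 ∈ A ∧ (e.1 = z ∨ Site.shift e.1 e.2 = z))).filter fun z => χ z = true).card = ((A.filter (fun z => ∃ e ∈ R, e.1 ∈ A ∧ Site.shift e.1 e.2 ∈ A ∧ (e.1 = z ∨ Site.shift e.1 e.2 = z))).filter fun z => χ z = false).card :=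
  fun _ A R P₁ P₂ σ hR hP₁ hP₂ hσ₁ hσ₂ hσσ hadj χ =>
    balanced_touched_of_blocks A R P₁ P₂ σ hR hP₁ hP₂ hσ₁ hσ₂ hσσ hadj χ

end Summit.QuantumFields.QCD.Theorems.PadTheFibreTwoStar
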